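import Summits.ValiantsHypothesis.ValiantsHypothesis.Theorems.LacunarySymmetroidMatrixDescartesVSQTriDesign

/-!
# `MatrixDescartes` census — exponent BOOKKEEPING for the recursive tridiagonal family (two more gaps)

HONEST FRAMING.  Integer inequalities only (val-V1-extremal engine seat val-v1x-eng-6 g2), used by the induction `…VSQGenInv`
(`ζ_sym(m,K) ≥ (m−1)(3K−6) + K − 1`).  Nothing here mentions the crux `MatrixDescartes` (stmt-ValiantsHypothesis-18050) or
`VP ≠ VNP`.  CONTENT: at a `b`-point `y = 2n + 2w − 1` the dominant `b`-term sits at least `qa + δ` high (`qa_dlt_le_eb`: the link of a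
finished level is weak even against the STRONG window two levels down); the dominant `c`-term sits above the `c`-constant
(`hc0_le_ec`); and the packaged late-point gaps `gap_late_U`, `gap_late_W`, `gap_late_top`, `gap_late_c`.
[folklore] Elementary.
-/

set_option linter.dupNamespace false
set_option autoImplicit false

namespace Summit.ValiantsHypothesis.ValiantsHypothesis.Theorems.LacunarySymmetroidMatrixDescartes.VSQ

/-- `qa + δ ≤ eb_w(2n + 2w − 1)`. [folklore] -/
theorem qa_dlt_le_eb {n w : ℕ} (hn : 2 ≤ n) (hw1 : 1 ≤ w) (hwn : w ≤ n) :
    qa n + dlt n ≤ eb n w (2 * n + 2 * w - 1) := by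
  have hn' : (2 : ℤ) ≤ n := by exact_mod_cast hn
  have hw1' : (1 : ℤ) ≤ w := by exact_mod_cast hw1
  have h2 := two_dlt n
  unfold eb hbN
  rw [dN_blk hw1 hwn]
  nlinarith [mul_nonneg (by linarith : (0 : ℤ) ≤ n) (sub_nonneg.2 hw1')]

/-- the dominant `c`-term sits above the `c`-constant: `4(n+1)² ≤ ec_{lc}(y)` in the three `c`-regimes. [folklore] -/
theorem hc0_le_ec {n : ℕ} (hn : 2 ≤ n) (j : ℕ) (hj : j ≤ n + 1) :
    4 * ((n : ℤ) + 1) ^ 2 ≤ ec n j (4 * n + 3 + 2 * j) := by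
  rcases Nat.eq_zero_or_pos j with h0 | h1
  · subst h0; rw [show (4 * (n : ℤ) + 3 + 2 * ((0 : ℕ) : ℤ)) = 4 * n + 3 by push_cast; ring, ec_zero]
  · by_cases hjn : j ≤ n
    · have := ec_blk_dom (v := 0) hn h1 hjn (by omega) (by omega)
      rw [show (4 * (n : ℤ) + 2 * j + 3) = 4 * n + 3 + 2 * j by ring, ec_zero] at this
      linarith
    · have hj' : j = n + 1 := by omega
      subst hj'
      have := ec_top_dom (v := 0) hn (by omega)
      rw [ec_zero] at this
      rw [show (4 * (n : ℤ) + 3 + 2 * ((n + 1 : ℕ) : ℤ)) = 6 * n + 5 by push_cast; ring]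
      linarith

/-- late point over a U-point one level down: `2(eb_n(σ+y) − δ) + 1 ≤ ea_{n+1}(σ+y) + ea_{j}(y)` (`y = 2j − 1`, `j ≤ n`). [folklore] -/
theorem gap_late_U {n j : ℕ} (hn : 2 ≤ n) (hj : j ≤ n) :
    2 * (eb n n ((sg n : ℤ) + (2 * (j : ℤ) - 1)) - dlt n) + 1 ≤
      ea n (n + 1) ((sg n : ℤ) + (2 * (j : ℤ) - 1)) + ea n j (2 * (j : ℤ) - 1) := by
  have hn' : (2 : ℤ) ≤ n := by exact_mod_cast hn
  have hj' : (j : ℤ) ≤ n := by exact_mod_cast hj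
  have hsg : (sg n : ℤ) = 4 * n + 4 := by unfold sg; push_cast; ring
  have h1 := gap0_late hn (x := (sg n : ℤ) + (2 * (j : ℤ) - 1)) (by rw [hsg]; linarith)
  rcases Nat.eq_zero_or_pos j with h0 | hj1
  · subst h0; rw [ea_zero] at ⊢; linarith
  · have h2 := qa_lt_ea_blk hn hj1 hj; linarith

/-- late point over a W-point one level down: `2(eb_n(σ+y) − δ) + 1 + qa ≤ ea_{n+1}(σ+y) + 2(eb_w(y) − δ)` (`y = 2n + 2w − 1`). [folklore] -/
theorem gap_late_W {n w : ℕ} (hn : 2 ≤ n) (hw1 : 1 ≤ w) (hwn : w ≤ n) :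
    2 * (eb n n ((sg n : ℤ) + (2 * n + 2 * w - 1)) - dlt n) + 1 + qa n ≤
      ea n (n + 1) ((sg n : ℤ) + (2 * n + 2 * w - 1)) + 2 * (eb n w (2 * n + 2 * w - 1) - dlt n) := by
  have hn' : (2 : ℤ) ≤ n := by exact_mod_cast hn
  have hw1' : (1 : ℤ) ≤ w := by exact_mod_cast hw1
  have hsg : (sg n : ℤ) = 4 * n + 4 := by unfold sg; push_cast; ring
  have h1 := gap0_late hn (x := (sg n : ℤ) + (2 * n + 2 * w - 1)) (by rw [hsg]; linarith)
  have h2 := qa_dlt_le_eb hn hw1 hwn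
  linarith

/-- late point over a late point: `2(eb_n(σ+y) − δ) + 1 ≤ ea_{n+1}(σ+y) + ea_{n+1}(y)` for `y ≥ 4n + 3`. [folklore] -/
theorem gap_late_top {n : ℕ} {y : ℤ} (hn : 2 ≤ n) (hy : 4 * (n : ℤ) + 3 ≤ y) :
    2 * (eb n n ((sg n : ℤ) + y) - dlt n) + 1 ≤ ea n (n + 1) ((sg n : ℤ) + y) + ea n (n + 1) y := by
  have hsg : (sg n : ℤ) = 4 * n + 4 := by unfold sg; push_cast; ring
  have h1 := gap0_late hn (x := (sg n : ℤ) + y) (by rw [hsg]; linarith)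
  have h2 := qa_lt_ea_top hn hy
  linarith

/-- late point over a bracket one level down: `2(eb_n(σ+y) − δ) + 1 ≤ ea_{n+1}(σ+y) + ea_{n}(y)` (`y = 2n + 2w − 1`). [folklore] -/
theorem gap_late_n {n w : ℕ} (hn : 2 ≤ n) (hw1 : 1 ≤ w) (hwn : w ≤ n) :
    2 * (eb n n ((sg n : ℤ) + (2 * n + 2 * w - 1)) - dlt n) + 1 ≤
      ea n (n + 1) ((sg n : ℤ) + (2 * n + 2 * w - 1)) + ea n n (2 * n + 2 * w - 1) := by
  have hn' : (2 : ℤ) ≤ n := by exact_mod_cast hn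
  have hw1' : (1 : ℤ) ≤ w := by exact_mod_cast hw1
  have hsg : (sg n : ℤ) = 4 * n + 4 := by unfold sg; push_cast; ring
  have h1 := gap0_late hn (x := (sg n : ℤ) + (2 * n + 2 * w - 1)) (by rw [hsg]; linarith)
  have h2 := qa_lt_ea_n hn hw1 hwn
  linarith

/-- late point over a `c`-point (two-level system): `2(eb_n(σ+y) − δ) + 1 ≤ ea_{n+1}(σ+y) + (ec_j(y) − 2δ)`, `y = 4n + 3 + 2j`. [folklore] -/
theorem gap_late_c {n j : ℕ} (hn : 2 ≤ n) (hj : j ≤ n + 1) :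
    2 * (eb n n ((sg n : ℤ) + (4 * n + 3 + 2 * j)) - dlt n) + 1 ≤
      ea n (n + 1) ((sg n : ℤ) + (4 * n + 3 + 2 * j)) + (ec n j (4 * n + 3 + 2 * j) - 2 * (dlt n : ℤ)) := by
  have hn' : (2 : ℤ) ≤ n := by exact_mod_cast hn
  have hsg : (sg n : ℤ) = 4 * n + 4 := by unfold sg; push_cast; ring
  have h1 := gap0_late hn (x := (sg n : ℤ) + (4 * n + 3 + 2 * j)) (by rw [hsg]; linarith)
  have h2 := hc0_le_ec hn j hj
  have h3 := hc0_eq n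
  linarith

end Summit.ValiantsHypothesis.ValiantsHypothesis.Theorems.LacunarySymmetroidMatrixDescartes.VSQ
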